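import Literature.NumberTheory.PAdicHodge.CyclotomicTowerPthPowers
import HarnessLib

/-!
# Isometric conjugates and integral power bases in `F̄`
# (toward Tate's almost étale lemma, Tate 1967 §3.2 Prop. 9 / Berger–Colmez (TS1))

Notation of the tree's `PAdicHodge` files: `F` a non-archimedean local field of characteristic `0` and
residue characteristic `p`, `K₀ = PadicBase F p hp ≅ ℚ_p`, `F̄ = NormedAlgClosure F` (ultrametric,
algebraically closed, `G₀ = Gal(F̄/K₀)` acting by isometries), and an intermediate field
`K₀ ⊆ M ⊆ F̄` with a finite extension `M ⊆ L ⊆ F̄` (`L : IntermediateField M F̄`). This file collects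
the valuation-theoretic linear algebra used by the elementary (Kummer) proof of Tate's almost étale lemma:

* `TateAlmostEtale.norm_algHom_apply` : **embeddings are isometric** — `‖σ z‖ = ‖z‖` for every
  `M`-embedding `σ : L → F̄` (a conjugate of `z` is `g • z`, `g ∈ G₀`); hence
  `TateAlmostEtale.norm_trace_le` : `‖Tr_{L/M} z‖ ≤ ‖z‖` and `TateAlmostEtale.norm_norm_eq` :
  `‖N_{L/M} z‖ = ‖z‖^{[L:M]}` (Mathlib `trace_eq_sum_embeddings`, `Algebra.norm_eq_prod_embeddings`);
* `TateAlmostEtale.norm_coeff_minpoly_le_one`, `norm_coeff_minpolyDiv_le_one` : for `θ ∈ L` with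
  `‖θ‖ ≤ 1` the coefficients of `minpoly M θ` and of `minpolyDiv M θ = minpoly/(X - θ)` are integral;
* `TateAlmostEtale.norm_repr_mul_norm_derivative_le` : **coordinates in an integral power basis have
  denominators at most the different** — if `pb` is a power basis of `L/M` with `‖pb.gen‖ ≤ 1` then the
  coordinates `λ_i` of `z = Σ λ_i pb.gen^i` satisfy `‖λ_i‖ ‖f'(pb.gen)‖ ≤ ‖z‖` (`f = minpoly`), by Euler's
  dual basis `b_i/f'(θ)` (Mathlib `Module.Basis.traceDual_powerBasis_eq`) and `‖Tr w‖ ≤ ‖w‖`.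

No `sorry`, no definitions. References: J. Tate, *p-divisible groups* (1967) §3.1–3.2 [Tate1967];
J. Neukirch, *Algebraic Number Theory*, II (4.8) (the absolute value on `F̄`) [NeukirchANT1999];
L. Berger, P. Colmez, Astérisque 319 (2008) Prop. 4.1.1 [BergerColmez2008].
-/

noncomputable section

open Polynomial IntermediateField Module ValuativeRel Field

namespace Literature.NumberTheory.PAdicHodge

namespace TateAlmostEtale

open Literature.NumberTheory.GaloisRepresentations
open Literature.NumberTheory.GaloisRepresentations.IsNonarchimedeanLocalField

variable {F : Type} [Field F] [ValuativeRel F] [TopologicalSpace F] [IsNonarchimedeanLocalField F]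
  [CharZero F] {p : ℕ} [Fact p.Prime] (hp : valuation F p < 1)
/-! ### §1 Isometric conjugates: norms of embeddings, traces and norms -/

section Conjugates

variable (M : IntermediateField (PadicBase F p hp) (NormedAlgClosure F))

/-- `M` has characteristic zero. [folklore] -/
private theorem charZero_M : CharZero M :=
  charZero_of_injective_algebraMap (algebraMap (PadicBase F p hp) M).injective

/-- **Embeddings are isometric**: for `K₀ ⊆ M ⊆ L ⊆ F̄` and an `M`-embedding `σ : L → F̄`,
`‖σ z‖ = ‖z‖` (`σ z` is a conjugate of `z` over `M`, hence `g • z` for some `g ∈ G₀`, an isometry).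
[cite: Tate1967, §3.1] [cite: NeukirchANT1999, Ch. II (4.8)] -/
theorem norm_algHom_apply (L : IntermediateField M (NormedAlgClosure F))
    (σ : L →ₐ[M] NormedAlgClosure F) (z : L) : ‖σ z‖ = ‖(z : NormedAlgClosure F)‖ := by
  have hint : IsIntegral M (z : NormedAlgClosure F) := Algebra.IsIntegral.isIntegral _
  have hmin : minpoly M (z : NormedAlgClosure F) = minpoly M z :=
    minpoly.algHom_eq L.val Subtype.val_injective z
  have hint' : IsIntegral M z := (isIntegral_algHom_iff L.val Subtype.val_injective).mp hint
  have hmem : σ z ∈ (minpoly M (z : NormedAlgClosure F)).aroots (NormedAlgClosure F) := by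
    rw [mem_aroots, hmin]
    refine ⟨minpoly.ne_zero hint', ?_⟩
    rw [aeval_algHom_apply, minpoly.aeval, map_zero]
  obtain ⟨g, -, hg⟩ :=
    BaseGaloisGroup.exists_smul_eq_of_mem_aroots_base hp M (z : NormedAlgClosure F) (σ z) hmem
  rw [hg, BaseGaloisGroup.norm_smul]

variable (L : IntermediateField M (NormedAlgClosure F)) [FiniteDimensional M L]

omit [FiniteDimensional M L] in
/-- `L/M` is separable (characteristic zero). [folklore] -/
private theorem isSeparable_L : Algebra.IsSeparable M L := by
  haveI := charZero_M hp M
  exact Algebra.IsAlgebraic.isSeparable_of_perfectField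

/-- **`‖Tr_{L/M}(z)‖ ≤ ‖z‖`**: the trace is the sum of the (isometric) conjugates.
[cite: Tate1967, §3.1] [cite: NeukirchANT1999, Ch. II (4.8)] -/
theorem norm_trace_le (z : L) :
    ‖((Algebra.trace M L z : M) : NormedAlgClosure F)‖ ≤ ‖(z : NormedAlgClosure F)‖ := by
  haveI := isSeparable_L hp M L
  have h := trace_eq_sum_embeddings (NormedAlgClosure F) (K := M) (L := L) (x := z)
  rw [IntermediateField.algebraMap_apply] at h
  rw [h]
  exact IsUltrametricDist.norm_sum_le_of_forall_le_of_nonneg (norm_nonneg _)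
    fun σ _ => (norm_algHom_apply hp M L σ z).le

/-- **`‖N_{L/M}(z)‖ = ‖z‖^{[L:M]}`**: the norm is the product of the (isometric) conjugates.
[cite: Tate1967, §3.1] [cite: NeukirchANT1999, Ch. II (4.8)] -/
theorem norm_norm_eq (z : L) :
    ‖((Algebra.norm M z : M) : NormedAlgClosure F)‖ = ‖(z : NormedAlgClosure F)‖ ^ finrank M L := by
  haveI := isSeparable_L hp M L
  have h := Algebra.norm_eq_prod_embeddings M (NormedAlgClosure F) z
  rw [IntermediateField.algebraMap_apply] at h
  rw [h, norm_prod, Finset.prod_congr rfl fun σ _ => norm_algHom_apply hp M L σ z,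
    Finset.prod_const, Finset.card_univ, AlgHom.card]

end Conjugates

/-! ### §2 Integral power bases: coefficients of `minpoly`, of `minpolyDiv`, and coordinates -/

section PowerBasisBounds

variable (M : IntermediateField (PadicBase F p hp) (NormedAlgClosure F))
  {L : IntermediateField M (NormedAlgClosure F)} [FiniteDimensional M L]

/-- **The minimal polynomial of an integral element has integral coefficients**: for `θ ∈ L`,
`K₀ ⊆ M ⊆ L ⊆ F̄`, `‖θ‖ ≤ 1`, every coefficient of `minpoly M θ` has norm `≤ 1` (it splits over `F̄`
as `Π (X - θ_i)` with isometric conjugates `θ_i`). [cite: Tate1967, §3.1] [cite: NeukirchANT1999, Ch. II (4.8)] -/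
theorem norm_coeff_minpoly_le_one (θ : L) (hθ : ‖(θ : NormedAlgClosure F)‖ ≤ 1) (i : ℕ) :
    ‖(((minpoly M θ).coeff i : M) : NormedAlgClosure F)‖ ≤ 1 := by
  have hint : IsIntegral M θ := .of_finite M θ
  have hmin : minpoly M (θ : NormedAlgClosure F) = minpoly M θ :=
    minpoly.algHom_eq L.val Subtype.val_injective θ
  set P' : (NormedAlgClosure F)[X] := (minpoly M θ).map (algebraMap M (NormedAlgClosure F)) with hP'
  have hsp : P'.Splits := IsAlgClosed.splits P'
  have hmo : P'.Monic := (minpoly.monic hint).map _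
  have heq : P' = (P'.roots.map (X - C ·)).prod := hsp.eq_prod_roots_of_monic hmo
  have hroots : ∀ r ∈ P'.roots, ‖r‖ ≤ 1 := by
    intro r hr
    have hr' : r ∈ (minpoly M (θ : NormedAlgClosure F)).aroots (NormedAlgClosure F) := by
      rw [hmin]; exact hr
    obtain ⟨g, -, hg⟩ :=
      BaseGaloisGroup.exists_smul_eq_of_mem_aroots_base hp M (θ : NormedAlgClosure F) r hr'
    rw [hg, BaseGaloisGroup.norm_smul]; exact hθ
  have h := norm_coeff_prod_X_sub_C_le P'.roots zero_le_one hroots i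
  rw [← heq, one_pow, hP', coeff_map] at h
  exact h

/-- **The coefficients of `minpolyDiv M θ = minpoly/(X - θ)` are integral** when `‖θ‖ ≤ 1` (downward
recursion `b_i = m_{i+1} + b_{i+1} θ`). [cite: Tate1967, §3.1] [cite: NeukirchANT1999, Ch. II (4.8)] -/
theorem norm_coeff_minpolyDiv_le_one (θ : L) (hθ : ‖(θ : NormedAlgClosure F)‖ ≤ 1) (i : ℕ) :
    ‖(((minpolyDiv M θ).coeff i : L) : NormedAlgClosure F)‖ ≤ 1 := by
  set Q := minpolyDiv M θ with hQ
  have key : ∀ k i : ℕ, Q.natDegree + 1 ≤ i + k →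
      ‖((Q.coeff i : L) : NormedAlgClosure F)‖ ≤ 1 := by
    intro k
    induction k with
    | zero =>
      intro i hi
      rw [coeff_eq_zero_of_natDegree_lt (by omega)]
      simp
    | succ k ih =>
      intro i hi
      rw [hQ, coeff_minpolyDiv, ← hQ]
      push_cast
      refine (IsUltrametricDist.norm_add_le_max _ _).trans (max_le ?_ ?_)
      · rw [IntermediateField.coe_algebraMap_apply, IntermediateField.algebraMap_apply]
        exact norm_coeff_minpoly_le_one hp M θ hθ (i + 1)
      · rw [norm_mul]
        exact mul_le_one₀ (ih (i + 1) (by omega)) (norm_nonneg _) hθ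
  exact key (Q.natDegree + 1) i (by omega)

/-- **Coordinates in an integral power basis have denominators at most `f'(θ)`**: if `L = M(θ)` with
power basis `pb` (`pb.gen = θ`, `‖θ‖ ≤ 1`) then for every `z ∈ L` and every `i`,
`‖λ_i‖ · ‖f'(θ)‖ ≤ ‖z‖`, where `z = Σ λ_i θ^i` and `f = minpoly M θ` — Euler's dual basis
`b_i/f'(θ)` (Mathlib `Module.Basis.traceDual_powerBasis_eq`) and `‖Tr w‖ ≤ ‖w‖`.
[cite: Tate1967, §3.2 Prop. 9] [cite: BergerColmez2008, Prop. 4.1.1] -/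
theorem norm_repr_mul_norm_derivative_le (pb : PowerBasis M L)
    (hgen : ‖(pb.gen : NormedAlgClosure F)‖ ≤ 1) (z : L) (i : Fin pb.dim) :
    ‖((pb.basis.repr z i : M) : NormedAlgClosure F)‖ *
        ‖((aeval pb.gen (derivative (minpoly M pb.gen)) : L) : NormedAlgClosure F)‖ ≤
      ‖(z : NormedAlgClosure F)‖ := by
  classical
  haveI := isSeparable_L hp M L
  have h1 : pb.basis.repr z i = Algebra.trace M L (z * pb.basis.traceDual i) := by
    conv_lhs => rw [← pb.basis.traceDual_traceDual]
    rw [Module.Basis.traceDual_repr_apply, Algebra.traceForm_apply]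
  rw [h1, Module.Basis.traceDual_powerBasis_eq]
  set H : L := aeval pb.gen (derivative (minpoly M pb.gen)) with hH
  set c : L := (minpolyDiv M pb.gen).coeff i with hc
  by_cases hH0 : H = 0
  · rw [hH0, div_zero, mul_zero, map_zero]
    simp
  have hHE : ((H : L) : NormedAlgClosure F) ≠ 0 := by
    intro h; apply hH0; exact_mod_cast h
  calc ‖((Algebra.trace M L (z * (c / H)) : M) : NormedAlgClosure F)‖ * ‖(H : NormedAlgClosure F)‖
      ≤ ‖((z * (c / H) : L) : NormedAlgClosure F)‖ * ‖(H : NormedAlgClosure F)‖ := by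
        gcongr; exact norm_trace_le hp M L _
    _ = ‖(z : NormedAlgClosure F)‖ * ‖(c : NormedAlgClosure F)‖ := by
        push_cast
        rw [norm_mul, norm_div, mul_assoc, div_mul_cancel₀ _ (norm_ne_zero_iff.mpr hHE)]
    _ ≤ ‖(z : NormedAlgClosure F)‖ * 1 := by
        gcongr; exact norm_coeff_minpolyDiv_le_one hp M pb.gen hgen i
    _ = ‖(z : NormedAlgClosure F)‖ := mul_one _

end PowerBasisBounds

end TateAlmostEtale

end Literature.NumberTheory.PAdicHodge

end
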